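/- Free-seat work of WIDTH SEAT `ym-line-cbag-p1-w2` (prover-ym-line-cbag-p1-w2-g17-0), route `EguchiKawaiDirectionLadder`
(ideator ym-idea-2, LINE 8), crux `TripleSmallBallMargin` (stmt-QuantumFields-27724): FIRST FILE of the margin door —
Weyl's integration formula + Fubini over the first link reduce the centre-symmetric small-ball event of the `d = 3`
Eguchi–Kawai a-priori measure to a bound on CENTRE-SYMMETRIC EIGENANGLE CONFIGURATIONS of the first link, plus the pair
bookkeeping (products over `j < k`, far-pair counts, the pair mass of a diagonal link) that the door
(`EguchiKawaiDirectionLadderMarginOfFibreBound.lean`) consumes.  Measure-theoretic and combinatorial bookkeeping only;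
nothing random-matrix-theoretic is proved.  The route bears on the barrier-ledger fact `EguchiKawaiBreakdown`; the
Yang–Mills mass gap is NOT proved by anything here. -/
import Summits.QuantumFields.YangMills.Theorems.EguchiKawaiDirectionLadderTripleSmallBallMarginProfile
import Summits.QuantumFields.YangMills.Theorems.EguchiKawaiDirectionLadderFirstLinkFibre
import Summits.QuantumFields.YangMills.Theorems.EguchiKawaiDirectionLadderFibreBoundDefs
import Summits.QuantumFields.YangMills.Theorems.EguchiKawaiDirectionLadderSpectralWindowLaw
import Literature.Probability.RandomMatrix.WeylIntegrationFormulaHolds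
import HarnessLib

/-!
# Route `EguchiKawaiDirectionLadder`, crux `TripleSmallBallMargin`: first-link Weyl reduction and pair bookkeeping

* `ekHaar_symSmallBall_le_of_eigenangle_bound` — for `d + 1` links: if `∏_{j<k}|e^{iθ_j} − e^{iθ_k}|² · q_t(θ) ≤ B` for
  every eigenangle configuration `θ` with `‖tr diag(e^{iθ})/N‖² ≤ δ`, where
  `q_t(θ) = ekHaar d N {W | S_R(Fin.cons diag(e^{iθ}) W) ≤ t}` is the first-link fibre of `{S_R ≤ t}`, then
  `ekHaar (d+1) N (Sym_δ ∩ {S_R ≤ t}) ≤ B` (the door uses `d + 1 = 3`; `d + 1 = 2` serves the pair small ball).  Proof: Fubini over the first link (`ekHaar_succ_eq_lintegral_firstFibre`, width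
  seat w4); the fibre of `Sym_δ ∩ {S_R ≤ t}` over `U₀` is empty unless `‖tr U₀/N‖² ≤ δ` and lies in the fibre of `{S_R ≤ t}`;
  `U₀ ↦ 𝟙{‖tr U₀/N‖² ≤ δ}·q_t(U₀)` is a measurable class function (`firstFibre_conj`, `measurable_measure_prodMk_left`);
  Weyl's integration formula (`weylIntegrationFormulaUN_holds`, tree theorem); pointwise bound; `(N!(2π)^N)⁻¹·(2π)^N ≤ 1`.
* `prod_Ioi_le_pow_mul_pow`, `sum_card_Ioi_fin_real`, `sum_card_filter_univ_eq_two_mul`, `farPairs_ge` — elementary pair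
  bookkeeping; `pairMass_diagPhases` — the pair mass (`…TripleSmallBallMarginDefs.pairMass`) of `diag(e^{iθ})` is the
  normalised count of ordered `r`-close index pairs.
-/

set_option autoImplicit false

noncomputable section

open MeasureTheory
open scoped ENNReal Real Classical
open Literature.Barriers.QuantumFields
open Literature.LinearAlgebra.Matrix (diagonalTorusHom)
open Literature.MathematicalPhysics.QuantumFieldTheory (haarProbability)
open Literature.Probability.RandomMatrix (weylIntegrationFormulaUN_holds)

namespace Summit.QuantumFields.YangMills.Theorems.EguchiKawaiDirectionLadder


/-! ### Step A — Weyl + Fubini over the first link: reduction to centre-symmetric eigenangle configurations -/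

/-- The trace of the eigenangle parametrisation: `tr diag(e^{iθ}) = Σ_j e^{iθ_j}`. -/
theorem trace_diagPhases (N : ℕ) (θ : Fin N → ℝ) :
    Matrix.trace ((diagonalTorusHom (Fin N) fun j => Circle.exp (θ j) : UN N) : Matrix (Fin N) (Fin N) ℂ) =
      ∑ j, Complex.exp (θ j * Complex.I) := by
  rw [SpectralWindow.coe_diagPhases, Matrix.trace_diagonal]

/-- **Reduction to the eigenangle sup.**  If `∏_{j<k}|e^{iθ_j} − e^{iθ_k}|² · q_t(θ) ≤ B` for every eigenangle configuration
`θ` with `‖tr diag(e^{iθ})/N‖² ≤ δ`, where `q_t(θ)` is the `ekHaar d N`-measure of the first-link fibre of `{S_R ≤ t}` over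
`diag(e^{iθ})` (a `d`-link event), then `ekHaar (d + 1) N (Sym_δ ∩ {S_R ≤ t}) ≤ B` (any number of links `d + 1`; the door
uses `d + 1 = 3`; `d + 1 = 2` is the pair small ball).  Proof: Fubini over the first link; the fibre of
`Sym_δ ∩ {S_R ≤ t}` over `U₀` is empty unless `‖tr U₀/N‖² ≤ δ` and is contained in the fibre of `{S_R ≤ t}`; the resulting
function of `U₀` is a measurable class function; Weyl's integration formula; the pointwise bound; `(N!(2π)^N)⁻¹(2π)^N ≤ 1`. -/
theorem ekHaar_symSmallBall_le_of_eigenangle_bound (d N : ℕ) (δ t : ℝ) (B : ℝ≥0∞)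
    (hB : ∀ θ : Fin N → ℝ,
      ‖Matrix.trace ((diagonalTorusHom (Fin N) fun j => Circle.exp (θ j) : UN N) : Matrix (Fin N) (Fin N) ℂ) /
          (N : ℂ)‖ ^ 2 ≤ δ →
      ENNReal.ofReal (∏ j : Fin N, ∏ k ∈ Finset.Ioi j,
          ‖Complex.exp (θ j * Complex.I) - Complex.exp (θ k * Complex.I)‖ ^ 2) *
        ekHaar d N {W : EKConfig d N |
          ekAction (Fin.cons (diagonalTorusHom (Fin N) fun j => Circle.exp (θ j)) W : EKConfig (d + 1) N) ≤ t} ≤ B) :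
    ekHaar (d + 1) N (ekSymRegion (d + 1) N δ ∩ {U | ekAction U ≤ t}) ≤ B := by
  set E : Set (EKConfig (d + 1) N) := ekSymRegion (d + 1) N δ ∩ {U | ekAction U ≤ t} with hE
  have hEm : MeasurableSet E :=
    (measurableSet_ekSymRegion δ).inter (measurableSet_le continuous_ekAction.measurable measurable_const)
  set A : Set (UN N) := {U₀ | ‖Matrix.trace (U₀ : Matrix (Fin N) (Fin N) ℂ) / (N : ℂ)‖ ^ 2 ≤ δ} with hA
  set q : UN N → ℝ≥0∞ := fun U₀ =>
    ekHaar d N {W : EKConfig d N | ekAction (Fin.cons U₀ W : EKConfig (d + 1) N) ≤ t} with hq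
  set G : UN N → ℝ≥0∞ := A.indicator q with hG
  -- (1) the fibres of `E` are dominated by `G`
  have hfib : ∀ U₀ : UN N, ekHaar d N {W : EKConfig d N | (Fin.cons U₀ W : EKConfig (d + 1) N) ∈ E} ≤ G U₀ := by
    intro U₀
    by_cases hU₀ : U₀ ∈ A
    · rw [hG, Set.indicator_of_mem hU₀]
      exact measure_mono fun W hW => hW.2
    · rw [hG, Set.indicator_of_notMem hU₀]
      have hempty : {W : EKConfig d N | (Fin.cons U₀ W : EKConfig (d + 1) N) ∈ E} = ∅ := by
        ext W
        simp only [Set.mem_setOf_eq, Set.mem_empty_iff_false, iff_false]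
        intro hW
        apply hU₀
        have h0 : ‖openLine 0 (Fin.cons U₀ W : EKConfig (d + 1) N)‖ ^ 2 ≤ δ := hW.1 0
        have h0' : ‖Matrix.trace (U₀ : Matrix (Fin N) (Fin N) ℂ) / (N : ℂ)‖ ^ 2 ≤ δ := by
          simpa [openLine] using h0
        exact h0'
      rw [hempty, measure_empty]
  -- (2) Fubini over the first link
  have h1 : ekHaar (d + 1) N E ≤ ∫⁻ U₀, G U₀ ∂(haarProbability (UN N)) := by
    rw [ekHaar_succ_eq_lintegral_firstFibre hEm]
    exact lintegral_mono hfib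
  -- (3) measurability of `G`
  have hAm : MeasurableSet A := by
    have hc : Continuous fun U₀ : UN N => ‖Matrix.trace (U₀ : Matrix (Fin N) (Fin N) ℂ) / (N : ℂ)‖ ^ 2 :=
      ((continuous_subtype_val.matrix_trace).div_const _).norm.pow 2
    exact (isClosed_le hc continuous_const).measurableSet
  have hS : MeasurableSet {p : UN N × EKConfig d N | ekAction (Fin.cons p.1 p.2 : EKConfig (d + 1) N) ≤ t} := by
    have hmeas : Measurable fun p : UN N × EKConfig d N => (Fin.cons p.1 p.2 : EKConfig (d + 1) N) := by
      have : (fun p : UN N × EKConfig d N => (Fin.cons p.1 p.2 : EKConfig (d + 1) N)) =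
          fun p => (MeasurableEquiv.piFinSuccAbove (fun _ : Fin (d + 1) => UN N) 0).symm p := by
        funext p; rw [← piFinSuccAbove_zero_symm_apply]
      rw [this]
      exact (MeasurableEquiv.piFinSuccAbove (fun _ : Fin (d + 1) => UN N) 0).symm.measurable
    exact measurableSet_le (continuous_ekAction.measurable.comp hmeas) measurable_const
  have hqm : Measurable q := measurable_measure_prodMk_left hS
  have hGm : Measurable G := hqm.indicator hAm
  -- (4) `G` is a class function
  have hconjE : ∀ (V : UN N) (U : EKConfig (d + 1) N), U ∈ {U : EKConfig (d + 1) N | ekAction U ≤ t} →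
      (fun μ => V * U μ * V⁻¹) ∈ {U : EKConfig (d + 1) N | ekAction U ≤ t} := by
    intro V U hU
    simp only [Set.mem_setOf_eq] at hU ⊢
    rw [ekAction_conj]; exact hU
  have hE'm : MeasurableSet {U : EKConfig (d + 1) N | ekAction U ≤ t} :=
    measurableSet_le continuous_ekAction.measurable measurable_const
  have hGconj : ∀ U V : UN N, G (V * U * V⁻¹) = G U := by
    intro U V
    have hAiff : V * U * V⁻¹ ∈ A ↔ U ∈ A := by
      simp only [hA, Set.mem_setOf_eq, coe_conj_link, trace_conj]
    have hqeq : q (V * U * V⁻¹) = q U := firstFibre_conj hE'm hconjE V U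
    by_cases hU : U ∈ A
    · rw [hG, Set.indicator_of_mem hU, Set.indicator_of_mem (hAiff.mpr hU), hqeq]
    · rw [hG, Set.indicator_of_notMem hU, Set.indicator_of_notMem (fun h => hU (hAiff.mp h))]
  -- (5) Weyl's integration formula
  have hW := weylIntegrationFormulaUN_holds N G hGm hGconj
  rw [hW] at h1
  -- (6) pointwise bound on the eigenangle integrand
  have hpt : ∀ θ : Fin N → ℝ,
      ENNReal.ofReal (∏ j : Fin N, ∏ k ∈ Finset.Ioi j,
          ‖Complex.exp (θ j * Complex.I) - Complex.exp (θ k * Complex.I)‖ ^ 2) *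
        G (diagonalTorusHom (Fin N) fun j => Circle.exp (θ j)) ≤ B := by
    intro θ
    by_cases hθ : (diagonalTorusHom (Fin N) fun j => Circle.exp (θ j)) ∈ A
    · rw [hG, Set.indicator_of_mem hθ]
      exact hB θ hθ
    · rw [hG, Set.indicator_of_notMem hθ, mul_zero]
      exact bot_le
  set box : Set (Fin N → ℝ) := Set.pi Set.univ (fun _ : Fin N => Set.Icc (-π) π) with hbox
  have hvol : volume box = ENNReal.ofReal ((2 * π) ^ N) := by
    rw [hbox, volume_pi_pi]
    simp only [Real.volume_Icc, Finset.prod_const, Finset.card_univ, Fintype.card_fin]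
    rw [show π - -π = 2 * π by ring, ENNReal.ofReal_pow (by positivity)]
  have hint : ∫⁻ θ in box, ENNReal.ofReal (∏ j : Fin N, ∏ k ∈ Finset.Ioi j,
          ‖Complex.exp (θ j * Complex.I) - Complex.exp (θ k * Complex.I)‖ ^ 2) *
        G (diagonalTorusHom (Fin N) fun j => Circle.exp (θ j)) ≤ B * ENNReal.ofReal ((2 * π) ^ N) := by
    calc ∫⁻ θ in box, ENNReal.ofReal (∏ j : Fin N, ∏ k ∈ Finset.Ioi j,
            ‖Complex.exp (θ j * Complex.I) - Complex.exp (θ k * Complex.I)‖ ^ 2) *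
          G (diagonalTorusHom (Fin N) fun j => Circle.exp (θ j))
        ≤ ∫⁻ _ in box, B := lintegral_mono fun θ => hpt θ
      _ = B * ENNReal.ofReal ((2 * π) ^ N) := by rw [lintegral_const, Measure.restrict_apply_univ, hvol]
  -- (7) constants: `(N!(2π)^N)⁻¹ · (2π)^N ≤ 1`
  have hconst : ENNReal.ofReal (((2 * π) ^ N * (N.factorial : ℝ))⁻¹) * ENNReal.ofReal ((2 * π) ^ N) ≤ 1 := by
    rw [← ENNReal.ofReal_mul (by positivity), ← ENNReal.ofReal_one]
    apply ENNReal.ofReal_le_ofReal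
    have hpi : (0 : ℝ) < (2 * π) ^ N := by positivity
    have hfac : (1 : ℝ) ≤ (N.factorial : ℝ) := by exact_mod_cast Nat.one_le_iff_ne_zero.mpr (Nat.factorial_ne_zero N)
    rw [mul_inv, mul_assoc, mul_comm ((N.factorial : ℝ))⁻¹, ← mul_assoc, inv_mul_cancel₀ hpi.ne', one_mul]
    exact inv_le_one_of_one_le₀ hfac
  calc ekHaar (d + 1) N E
      ≤ ENNReal.ofReal (((2 * π) ^ N * (N.factorial : ℝ))⁻¹) * (B * ENNReal.ofReal ((2 * π) ^ N)) :=
        h1.trans (mul_le_mul' le_rfl hint)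
    _ = (ENNReal.ofReal (((2 * π) ^ N * (N.factorial : ℝ))⁻¹) * ENNReal.ofReal ((2 * π) ^ N)) * B := by ring
    _ ≤ 1 * B := mul_le_mul' hconst le_rfl
    _ = B := one_mul B


/-! ### Step B — pair bookkeeping: products over `j < k`, far-pair counts, the pair mass of a diagonal link -/

/-- Product bookkeeping: if every pair weight is `≤ a` and the selected pairs weigh `≤ a·ρ` (`0 ≤ ρ ≤ 1`), then
`∏_{j<k} w_jk ≤ a^{#pairs} · ρ^{#selected pairs}`. -/
theorem prod_Ioi_le_pow_mul_pow {N : ℕ} (w : Fin N → Fin N → ℝ) (p : Fin N → Fin N → Prop)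
    [∀ j k, Decidable (p j k)] {a ρ : ℝ}
    (hw0 : ∀ j k, 0 ≤ w j k) (hwa : ∀ j k, w j k ≤ a) (hwb : ∀ j k, p j k → w j k ≤ a * ρ) :
    ∏ j : Fin N, ∏ k ∈ Finset.Ioi j, w j k ≤
      a ^ (∑ j : Fin N, (Finset.Ioi j).card) * ρ ^ (∑ j : Fin N, ((Finset.Ioi j).filter (p j)).card) := by
  have hpt : ∀ j k, w j k ≤ a * (if p j k then ρ else 1) := by
    intro j k
    by_cases hp : p j k
    · rw [if_pos hp]; exact hwb j k hp
    · rw [if_neg hp, mul_one]; exact hwa j k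
  have hfac : ∀ j : Fin N, ∏ k ∈ Finset.Ioi j, (a * (if p j k then ρ else 1)) =
      a ^ (Finset.Ioi j).card * ρ ^ ((Finset.Ioi j).filter (p j)).card := by
    intro j
    rw [Finset.prod_mul_distrib, Finset.prod_const, Finset.prod_ite, Finset.prod_const, Finset.prod_const_one,
      mul_one]
  calc ∏ j : Fin N, ∏ k ∈ Finset.Ioi j, w j k
      ≤ ∏ j : Fin N, ∏ k ∈ Finset.Ioi j, (a * (if p j k then ρ else 1)) :=
        Finset.prod_le_prod (fun j _ => Finset.prod_nonneg fun k _ => hw0 j k) fun j _ =>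
          Finset.prod_le_prod (fun k _ => hw0 j k) fun k _ => hpt j k
    _ = ∏ j : Fin N, (a ^ (Finset.Ioi j).card * ρ ^ ((Finset.Ioi j).filter (p j)).card) :=
        Finset.prod_congr rfl fun j _ => hfac j
    _ = a ^ (∑ j : Fin N, (Finset.Ioi j).card) * ρ ^ (∑ j : Fin N, ((Finset.Ioi j).filter (p j)).card) := by
        rw [Finset.prod_mul_distrib, Finset.prod_pow_eq_pow_sum, Finset.prod_pow_eq_pow_sum]

/-- The number of pairs `j < k` in `Fin N`, in `ℝ`: `Σ_j #(Ioi j) = (N² − N)/2`. -/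
theorem sum_card_Ioi_fin_real (N : ℕ) :
    ((∑ j : Fin N, (Finset.Ioi j).card : ℕ) : ℝ) = ((N : ℝ) ^ 2 - N) / 2 := by
  have h := SpectralWindow.sum_card_Ioi_fin N
  have h2 : 2 * (N * (N - 1) / 2) = N * (N - 1) := Nat.two_mul_div_two_of_even (Nat.even_mul_pred_self N)
  have h3 : (2 : ℝ) * ((∑ j : Fin N, (Finset.Ioi j).card : ℕ) : ℝ) = (N : ℝ) * ((N - 1 : ℕ) : ℝ) := by
    rw [h]; exact_mod_cast h2
  rcases Nat.eq_zero_or_pos N with hN | hN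
  · subst hN; simp
  · have hcast : ((N - 1 : ℕ) : ℝ) = (N : ℝ) - 1 := by
      rw [Nat.cast_sub (Nat.one_le_of_lt hN)]; simp
    rw [hcast] at h3
    linarith [h3]

/-- Counting ordered versus increasing pairs for a symmetric, irreflexive relation:
`Σ_j #{k : p j k} = 2 · Σ_j #{k > j : p j k}`. -/
theorem sum_card_filter_univ_eq_two_mul {N : ℕ} (p : Fin N → Fin N → Prop) [∀ j k, Decidable (p j k)]
    (hsymm : ∀ j k, p j k ↔ p k j) (hirr : ∀ j, ¬ p j j) :
    (∑ j : Fin N, (Finset.univ.filter (p j)).card) = 2 * ∑ j : Fin N, ((Finset.Ioi j).filter (p j)).card := by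
  have hsplit : ∀ j : Fin N, Finset.univ.filter (p j) =
      (Finset.Iio j).filter (p j) ∪ (Finset.Ioi j).filter (p j) := by
    intro j; ext k
    simp only [Finset.mem_filter, Finset.mem_univ, true_and, Finset.mem_union, Finset.mem_Iio, Finset.mem_Ioi]
    constructor
    · intro hk
      have hne : k ≠ j := fun h => hirr j (h ▸ hk)
      rcases lt_or_gt_of_ne hne with h | h
      · exact Or.inl ⟨h, hk⟩
      · exact Or.inr ⟨h, hk⟩
    · rintro (⟨-, hk⟩ | ⟨-, hk⟩) <;> exact hk
  have hdisj : ∀ j : Fin N, Disjoint ((Finset.Iio j).filter (p j)) ((Finset.Ioi j).filter (p j)) := by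
    intro j
    rw [Finset.disjoint_left]
    intro k hk hk'
    exact lt_asymm (Finset.mem_Iio.1 (Finset.mem_filter.1 hk).1) (Finset.mem_Ioi.1 (Finset.mem_filter.1 hk').1)
  have h1 : ∑ j : Fin N, (Finset.univ.filter (p j)).card =
      ∑ j : Fin N, ((Finset.Iio j).filter (p j)).card + ∑ j : Fin N, ((Finset.Ioi j).filter (p j)).card := by
    rw [← Finset.sum_add_distrib]
    refine Finset.sum_congr rfl fun j _ => ?_
    rw [hsplit j, Finset.card_union_of_disjoint (hdisj j)]
  have h2 : ∑ j : Fin N, ((Finset.Iio j).filter (p j)).card = ∑ j : Fin N, ((Finset.Ioi j).filter (p j)).card := by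
    simp_rw [Finset.card_filter]
    rw [Finset.sum_comm' (t' := Finset.univ) (s' := fun k => Finset.Ioi k)
      (h := fun j k => by simp [Finset.mem_Iio, Finset.mem_Ioi])]
    refine Finset.sum_congr rfl fun k _ => Finset.sum_congr rfl fun j _ => ?_
    exact if_congr (hsymm j k) rfl rfl
  rw [h1, h2, two_mul]

/-- The pair mass of a diagonal link `diag(e^{iθ})` at resolution `r` is the normalised count of ordered index pairs
`(j,k)` with `|e^{iθ_j} − e^{iθ_k}| ≤ r`. -/
theorem pairMass_diagPhases (N : ℕ) (r : ℝ) (θ : Fin N → ℝ) :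
    pairMass r (diagonalTorusHom (Fin N) fun j => Circle.exp (θ j)) =
      (∑ j : Fin N, ((Finset.univ.filter fun k : Fin N =>
          ‖Complex.exp (θ j * Complex.I) - Complex.exp (θ k * Complex.I)‖ ≤ r).card : ℝ)) / (N : ℝ) ^ 2 := by
  unfold pairMass spec
  rw [SpectralWindow.charpoly_roots_diagPhases, Multiset.map_map, ← Finset.sum_eq_multiset_sum]
  congr 1
  refine Finset.sum_congr rfl fun j _ => ?_
  simp only [Function.comp_apply, Multiset.filter_map, Multiset.card_map]
  rw [← Finset.filter_val, ← Finset.card_def]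

/-! ### Far-pair count -/

/-- Far-pair count: if the ordered `r`-close pairs (diagonal included) number at most `S₀·N²`, then at least
`(1 − S₀)N²/2` increasing pairs are far. -/
theorem farPairs_ge {N : ℕ} (f : Fin N → ℂ) {r S₀ : ℝ} (hr : 0 ≤ r)
    (hnear : (∑ j : Fin N, ((Finset.univ.filter fun k : Fin N => ‖f j - f k‖ ≤ r).card : ℝ)) ≤ S₀ * (N : ℝ) ^ 2) :
    (1 - S₀) * (N : ℝ) ^ 2 / 2 ≤
      (∑ j : Fin N, ((Finset.Ioi j).filter fun k : Fin N => ¬ ‖f j - f k‖ ≤ r).card : ℕ) := by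
  have hcomp : ∀ j : Fin N, ((Finset.univ.filter fun k => ‖f j - f k‖ ≤ r).card : ℝ) +
      ((Finset.univ.filter fun k => ¬ ‖f j - f k‖ ≤ r).card : ℝ) = N := by
    intro j
    have h := Finset.card_filter_add_card_filter_not (s := (Finset.univ : Finset (Fin N)))
      (fun k : Fin N => ‖f j - f k‖ ≤ r)
    rw [Finset.card_univ, Fintype.card_fin] at h
    exact_mod_cast h
  have htwo := sum_card_filter_univ_eq_two_mul (fun j k : Fin N => ¬ ‖f j - f k‖ ≤ r)
    (fun j k => by rw [norm_sub_rev]) (fun j => by simp [hr])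
  have hsum : (∑ j : Fin N, ((Finset.univ.filter fun k => ¬ ‖f j - f k‖ ≤ r).card : ℝ)) +
      ∑ j : Fin N, ((Finset.univ.filter fun k => ‖f j - f k‖ ≤ r).card : ℝ) = (N : ℝ) ^ 2 := by
    rw [← Finset.sum_add_distrib]
    rw [show (∑ j : Fin N, (((Finset.univ.filter fun k => ¬ ‖f j - f k‖ ≤ r).card : ℝ) +
        ((Finset.univ.filter fun k => ‖f j - f k‖ ≤ r).card : ℝ))) = ∑ _j : Fin N, (N : ℝ) from
      Finset.sum_congr rfl fun j _ => by rw [add_comm]; exact hcomp j]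
    rw [Finset.sum_const, Finset.card_univ, Fintype.card_fin, nsmul_eq_mul, sq]
  have hcast : (∑ j : Fin N, ((Finset.univ.filter fun k => ¬ ‖f j - f k‖ ≤ r).card : ℝ)) =
      2 * ((∑ j : Fin N, ((Finset.Ioi j).filter fun k : Fin N => ¬ ‖f j - f k‖ ≤ r).card : ℕ) : ℝ) := by
    exact_mod_cast htwo
  linarith

end Summit.QuantumFields.YangMills.Theorems.EguchiKawaiDirectionLadder

end
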